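import Summits.QuantumFields.YangMills.Theorems.F4SubCurvatureDoorGlobalReductionCertificate
import Summits.QuantumFields.YangMills.Theorems.F4SubCurvatureDoorShortRootRigiditySliceInClass
import Mathlib
import HarnessLib

/-!
# LINE g20-A «ANGULAR TYPE» — a proof skeleton for the crux `F4SubCurvatureDoor.ShortRootRigidity` ⟨stmt-QuantumFields-23035⟩

Ideator seat `ym-idea-3`, generation g20 (technique card: positivity / convexity).  This file REFINES the registered LINE g19-A
`Lines/transverse_slice.lean` (same crux): it keeps the slice reduction (obligations `SliceInClass` ✓p706499, `SliceDensity` ✓p704575,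
`OddModeRigidity` open — cited BY NAME from the registered Theorems files) and replaces the XL heart `PlanarRigidity` («every kernel of the
hexagonal planar class is O(2)-invariant») by a THREE-STEP ANGULAR-TYPE ARGUMENT:

* `PlanarSpectralCone` (stub (C), the new lever, BUDGET-FREE): for `k ∈ InPlanarClass` and `ε > 0` the shifted axis restriction
  `(t, b) ↦ k(ε + t, b)` extends holomorphically to the FORWARD TUBE `{(ζ, β) ∈ ℂ² : |Im β| < Re ζ}` with the bound
  `‖F(ζ, β)‖ ≤ k(ε + Re ζ − |Im β|, 0)` — the Laplace–Fourier measure of the frame is carried by the forward light cone `{E ≥ |p|}`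
  (spectral condition `H ≥ |P|` of the would-be 1+1-dimensional theory).  Plan (card §Hardest stub): OS two-slot sector continuation on
  the 60°-frame pairs ⇒ joint analyticity on the open wedges; the CROSS THEOREM (Siciak–Zahariuta, JarnickiPflug2011 Ch. 5) at the six frame
  rays (a 60°-neighbour frame has time coordinate `t/2 > 0` there — this is where `D₆` beats `D₄`); Paley–Wiener for the positive spatial
  measures ⇒ tube aperture `τ₀ > 0`; at the critical points `t·n_θ + iτt·n_θ^⊥` the three frame tubes of equal aperture `τ` meet and their
  common edge is a complex line iff `τ = 1` (`det = (√3/2)(τ² − 1)`), so for `τ < 1` the local Bochner tube theorem extends across the edge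
  and Paley–Wiener raises the aperture uniformly ⇒ `τ = 1`; sup-norm bookkeeping ⇒ cone support.
* `AngularContinuation` (stub, M): the cone bound makes the angular trace `φ ↦ k(r cos φ, r sin φ)` the restriction of an ENTIRE,
  `π/3`-periodic function `G` (six half-circle charts, one per frame direction `jπ/3`, glued by the identity theorem) with
  `‖G(φ + iψ)‖ ≤ k(r cos(φ − jπ/3) e^{−|ψ|}, 0)`; the planar budget `‖y‖⁶ k → 0` turns this into `o(e^{6|ψ|})`.
* `PeriodicEntireRigidity` (stub, M, classical): an entire `π/3`-periodic function of little-o exponential type `6` is constant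
  (its Fourier modes are `e^{6inz}`; `|c_n| ≤ e^{−6|n|Ψ}·o(e^{6Ψ}) → 0` for `n ≠ 0`).  The budget exponent `6` of the planar class is
  EXACTLY the first non-trivial `D₆` frequency: the threshold witnesses `K₆(mr) cos 6φ` (budget `O`, not `o`) are where it is sharp.

`planarRigidity_of_angularType` (PROVED here) assembles the three into `PlanarRigidity`; `ShortRootRigidity_of_angularType` (PROVED, the
only theorem of this file concluding the crux) composes with the landed obligations and the tree certificate
`F4SubCurvatureDoorGlobalReduction.shortRootRigidity_of_global`.  `stub_planarRigidity` is kept (sorried, unused by the composition) so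
that the direct attack of LINE g19-A stays registered and claimable.  No summit and no rung is proved by this file.
-/

noncomputable section

namespace Summit.QuantumFields.YangMills.Cruxes.ShortRootRigidity.AngularType

open scoped Topology BigOperators RealInnerProductSpace
open Filter Set MeasureTheory
open Literature.MathematicalPhysics.QuantumLattice (timeReflection siteToE)
open Summit.QuantumFields.YangMills.Cruxes.OSLegsAtWeakCouplingC.Sketch (IsSignedPerm)
open Summit.QuantumFields.YangMills.Theorems.F4SubCurvatureDoorMirrorAnalyticityRegistered (E4 InClass)
open Summit.QuantumFields.YangMills.Theorems.F4SubCurvatureDoorSliceDensityRegistered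
  (E2 planeEmb perpEmb weight slice EvenPartSliceInvariant SliceDensity stub_sliceDensity)
open Summit.QuantumFields.YangMills.Theorems.F4SubCurvatureDoorSliceInClassRegistered
  (hexReflection InPlanarClass SliceInClass stub_sliceInClass)
open Summit.QuantumFields.YangMills.Theses.F4SubCurvatureDoor (ShortRootRigidity)

/-! ## Planar coordinates -/

/-- The point `(a, b)` of the plane. [problem-side definition] -/
def mk2 (a b : ℝ) : E2 := (WithLp.equiv 2 (Fin 2 → ℝ)).symm ![a, b]

/-- Polar coordinates `(r cos φ, r sin φ)`. [problem-side definition] -/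
def polar (r φ : ℝ) : E2 := mk2 (r * Real.cos φ) (r * Real.sin φ)

theorem mk2_eta (y : E2) : mk2 (y 0) (y 1) = y := by
  ext i; fin_cases i <;> simp [mk2]

theorem norm_sq_eq (y : E2) : ‖y‖ ^ 2 = y 0 ^ 2 + y 1 ^ 2 := by
  rw [EuclideanSpace.real_norm_sq_eq, Fin.sum_univ_two]

/-- Polar form of a non-zero planar vector. [bookkeeping] -/
theorem exists_polar {y : E2} (hy : y ≠ 0) : ∃ φ : ℝ, y = polar ‖y‖ φ := by
  have hr : 0 < ‖y‖ := norm_pos_iff.mpr hy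
  set w : ℂ := ⟨y 0, y 1⟩ with hw
  have hnorm : ‖w‖ = ‖y‖ := by
    rw [Complex.norm_def, Complex.normSq_mk, ← sq, ← sq, ← norm_sq_eq]
    exact Real.sqrt_sq hr.le
  have hw0 : w ≠ 0 := by
    intro h0; rw [h0, norm_zero] at hnorm; linarith
  refine ⟨Complex.arg w, ?_⟩
  have hc : y 0 = ‖y‖ * Real.cos (Complex.arg w) := by
    have := Complex.cos_arg hw0
    rw [hnorm] at this
    field_simp at this
    simpa [hw, mul_comm] using this.symm
  have hs : y 1 = ‖y‖ * Real.sin (Complex.arg w) := by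
    have := Complex.sin_arg w
    rw [hnorm] at this
    field_simp at this
    simpa [hw, mul_comm] using this.symm
  rw [polar, ← hc, ← hs, mk2_eta]

/-! ## The statements -/

/-- The forward tube of a frame: `{(ζ, β) ∈ ℂ² : |Im β| < Re ζ}`. [problem-side definition] -/
def fwdTube : Set (ℂ × ℂ) := {w | |w.2.im| < w.1.re}

/-- «PLANAR SPECTRAL CONE» for one planar kernel (frame `e₀`; the other two frames follow by `D₆`): for every `ε > 0` the shifted
axis restriction `(t, b) ↦ k(ε + t, b)` is the real trace of a function holomorphic on the forward tube and bounded there by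
`k(ε + Re ζ − |Im β|, 0)` — equivalently, the Laplace–Fourier measure of the frame is carried by the forward light cone `{E ≥ |p|}`.
BUDGET-FREE. [problem-side definition] -/
def PlanarSpectralCone (k : E2 → ℝ) : Prop :=
  ∀ ε : ℝ, 0 < ε → ∃ F : ℂ × ℂ → ℂ, DifferentiableOn ℂ F fwdTube ∧
    (∀ t b : ℝ, 0 < t → F ((t : ℂ), (b : ℂ)) = k (mk2 (ε + t) b)) ∧
    ∀ w ∈ fwdTube, ‖F w‖ ≤ k (mk2 (ε + (w.1.re - |w.2.im|)) 0)

/-- «ANGULAR CONTINUATION OF TYPE SIX» for one planar kernel: on every circle the angular trace is the restriction of an entire,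
`π/3`-periodic function of little-o exponential type `6`. [problem-side definition] -/
def AngularContinuation (k : E2 → ℝ) : Prop :=
  ∀ r : ℝ, 0 < r → ∃ G : ℂ → ℂ, Differentiable ℂ G ∧
    (∀ φ : ℝ, G φ = k (polar r φ)) ∧
    (∀ z : ℂ, G (z + ((Real.pi / 3 : ℝ) : ℂ)) = G z) ∧
    ∀ δ : ℝ, 0 < δ → ∃ Ψ : ℝ, ∀ φ ψ : ℝ, Ψ ≤ |ψ| → ‖G (φ + ψ * Complex.I)‖ ≤ δ * Real.exp (6 * |ψ|)

/-- «PERIODIC ENTIRE RIGIDITY» (classical, one complex variable): an entire `π/3`-periodic function of little-o exponential type `6`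
is constant. [problem-side definition] -/
def PeriodicEntireRigidity : Prop :=
  ∀ G : ℂ → ℂ, Differentiable ℂ G → (∀ z : ℂ, G (z + ((Real.pi / 3 : ℝ) : ℂ)) = G z) →
    (∀ δ : ℝ, 0 < δ → ∃ Ψ : ℝ, ∀ φ ψ : ℝ, Ψ ≤ |ψ| → ‖G (φ + ψ * Complex.I)‖ ≤ δ * Real.exp (6 * |ψ|)) →
    ∀ z w : ℂ, G z = G w

/-- Obligation (2) of LINE g19-A «PLANAR RIGIDITY» (verbatim): every kernel of the planar class is `O(2)`-invariant off `0`.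
[problem-side definition] -/
def PlanarRigidity : Prop :=
  ∀ k : E2 → ℝ, InPlanarClass k → ∀ (R : E2 ≃ₗᵢ[ℝ] E2) (y : E2), y ≠ 0 → k (R y) = k y

/-- Obligation (4) of LINE g19-A «ODD-MODE RIGIDITY» (verbatim). [problem-side definition] -/
def OddModeRigidity : Prop :=
  ∀ K : E4 → ℝ, InClass K → EvenPartSliceInvariant K → ∀ (R : E4 ≃ₗᵢ[ℝ] E4) (x : E4), K (R x) = K x

/-! ## Registered stubs -/

/-- Registered stub (C) «PLANAR SPECTRAL CONE» — the new lever, XL, budget-free. -/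
theorem stub_planarSpectralCone : ∀ k : E2 → ℝ, InPlanarClass k → PlanarSpectralCone k := by
  sorry

/-- Registered stub (A) «ANGULAR CONTINUATION» — M (six cone charts glued by the identity theorem; budget ⇒ little-o type). -/
theorem stub_angularContinuation : ∀ k : E2 → ℝ, InPlanarClass k → PlanarSpectralCone k → AngularContinuation k := by
  sorry

/-- Registered stub (P) «PERIODIC ENTIRE RIGIDITY» — M, classical (Fourier coefficients of a periodic entire function + contour shift). -/
theorem stub_periodicEntireRigidity : PeriodicEntireRigidity := by
  sorry

/-- Registered stub (2) of LINE g19-A, kept registered so that the direct attack stays claimable (NOT used by the composition below,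
which goes through (C) + (A) + (P) instead). -/
theorem stub_planarRigidity : PlanarRigidity := by
  sorry

/-- Registered stub (4) of LINE g19-A «ODD-MODE RIGIDITY» (shared, character-identical). -/
theorem stub_oddModeRigidity : OddModeRigidity := by
  sorry

/-! ## Composition -/

/-- **The angular-type assembly (PROVED)**: spectral cone + angular continuation + periodic entire rigidity ⇒ planar rigidity.
[problem-side composition] -/
theorem planarRigidity_of_angularType
    (hcone : ∀ k : E2 → ℝ, InPlanarClass k → PlanarSpectralCone k)
    (hang : ∀ k : E2 → ℝ, InPlanarClass k → PlanarSpectralCone k → AngularContinuation k)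
    (hper : PeriodicEntireRigidity) : PlanarRigidity := by
  intro k hk R y hy
  have hr : 0 < ‖y‖ := norm_pos_iff.mpr hy
  have hRy : R y ≠ 0 := fun h => hy (by simpa using congrArg R.symm h)
  obtain ⟨φ, hφ⟩ := exists_polar hy
  obtain ⟨φ', hφ'⟩ := exists_polar hRy
  rw [LinearIsometryEquiv.norm_map] at hφ'
  obtain ⟨G, hG, hGk, hGper, hGgrowth⟩ := hang k hk (hcone k hk) ‖y‖ hr
  have hconst : G (φ' : ℂ) = G (φ : ℂ) := hper G hG hGper hGgrowth φ' φ
  rw [hGk, hGk] at hconst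
  calc k (R y) = k (polar ‖y‖ φ') := by rw [hφ']
    _ = k (polar ‖y‖ φ) := by exact_mod_cast hconst
    _ = k y := by rw [← hφ]

/-- **Composition (kernel-checked): the registered stubs imply the route crux `ShortRootRigidity` BY NAME** — through the landed
obligations `stub_sliceInClass` (p706499), `stub_sliceDensity` (p704575), the angular-type assembly, the shared stub `stub_oddModeRigidity`
and the tree certificate `shortRootRigidity_of_global` (C3 ⇒ ⟨23035⟩).  The only theorem of this file concluding the crux.
[problem-side composition] -/
theorem ShortRootRigidity_of_angularType : ShortRootRigidity :=
  Summit.QuantumFields.YangMills.Theorems.F4SubCurvatureDoorGlobalReduction.shortRootRigidity_of_global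
    (fun K hK hbd hB hRP hbud hlat =>
      stub_oddModeRigidity K ⟨hK, hbd, hB, hRP, hbud, hlat⟩
        (stub_sliceDensity K ⟨hK, hbd, hB, hRP, hbud, hlat⟩ (fun a R y hy =>
          planarRigidity_of_angularType stub_planarSpectralCone stub_angularContinuation stub_periodicEntireRigidity
            (slice K a) (stub_sliceInClass K ⟨hK, hbd, hB, hRP, hbud, hlat⟩ a) R y hy)))

end Summit.QuantumFields.YangMills.Cruxes.ShortRootRigidity.AngularType

end
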